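import Summits.Ventures.HSemireg.Pad4TowerA2IMu4
import Summits.Ventures.HSemireg.Pad4TowerRuleDMu4Slice

/-!
# Venture HSemireg — PAD-4: the (F1ℝ) slice of the μ₄ LINE form of LEMMA A∪2I′ — `Pad4TowerLemmaT.StaticDeadW0` implies
# `A2IDeadMu4Line` on the embedded configuration (proved)

HONEST FRAMING. Lean index of the computation cell `pub-hsemireg` (S4-PUSH, H2 door PAD-4), typed by the Ventures-side typer
`hodge-lit-semireg-typer-2` (g2); companion of `Pad4TowerA2IMu4` (LEMMA A∪2I′, PAD4-BALANCED §17, clean sufficient form on 𝔅(μ₄))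
in the role `Pad4TowerRuleDMu4Slice` plays for RULE D: a FAITHFULNESS CERTIFICATE against the refereed (F1ℝ) file. The `W = ∅`
own-ray static kill `Pad4TowerLemmaT.StaticDeadW0 C Z f′ s′ f″` (§18 (vii), hypothesis of LEMMA T, ×2 s4-ref g70 ∕ s4-ref-2 g9–g10:
`Z` has the `O`-factor `f″` and a pure ray on `(f′, s′)`; every present partner along `(f′,s′)` has `f″` served above in BOTH
directions; no lifted class on the line is a `P`-cell) IMPLIES, on the slice embedding `(a,b) ↦ (a+b, a−b, 0)` of
`Pad4TowerRuleDMu4Slice`, the μ₄ LINE kill `A2IDeadMu4Line (sliceConfig C) (sliceCell Z) f′ (dirOf s′) f″ (dirOf t)` for EITHER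
real direction `t` — proved with no further hypothesis (`staticDeadW0_slice`).

WHAT THE PROOF CHECKS. `f″` is an apex (indeed `O`); the row `u = dirOf s′` is demanded (`2·Z f′ s′ ≠ 0`); `W_{f″} = ∅` and «no
partner off the frame» hold on the slice because nothing lies below `O` and slice legs run in the two real directions only
(`uPartner_slice_iff`); each `u`-partner is an embedded `Pad4TowerLemmaT` partner (side `s′` forced by `dirOf`), whose two
`f″`-servers (directions `0` and `1` = `dirOf 0`, `dirOf 1`) embed as `UPartner`s; and a would-be POLLUTER `P′ = sliceCell Q` of
such a server is a LIFTED CLASS of `Pad4TowerLemmaT` — (C1)+(C2) give the agreement and the depth, and (C3) «`z ≠ 0`, not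
timelike» at the `O`-point reads `(a−b)² ≥ (a+b)²`, i.e. `a·b = 0` with `(a,b) ≠ (0,0)`: a pure ray on one side of `f″`
(`pureRay_of_not_timelike`) — which `StaticDeadW0` forbids. So the μ₄ polluter census restricted to the slice is EXACTLY the
(F1ℝ) lifted-class census (species (3b); (3d) is empty in the orthant), as `Pad4TowerA2IMu4`'s docstring says.

WHAT IS NOT HERE. The converse (the μ₄ LINE form on the slice is more permissive than `StaticDeadW0`: one clean direction instead
of two served ones, lifted classes forbidden only below each partner's depth along the chosen direction — it is implied by, not
equivalent to, the static form; cf. `Pad4TowerLemmaA2I.A2IDead_of_staticDeadW0`); any (E1)-meaning (pencil, cited in the two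
parent files). Nothing is a statement about a variety, a sheaf, `σ`, a seed or an abelian variety; NOTHING HERE SAYS THAT HC ∕
HC_CM ∕ HC_AV ∕ W₆ ∕ HC_Kum4Type HOLDS OR FAILS. No `instance`, no notation, no named fact, 0 `sorry`; axioms standard.

SOURCES (sha16): `Pad4TowerA2IMu4.lean`, `Pad4TowerRuleDMu4Slice.lean`, `Pad4TowerRuleDMu4.lean` (this typer, same filing);
`Pad4TowerLemmaT.lean` bfb2cc0a1a90b649 (`StaticDeadW0`, `LiftedClass`, `pureRay`, `isO`, `ServedAbove`); PAD4-BALANCED-search-1.md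
v2.9 93790c5bf8784622 §17 (census species (3b) «NULL-LIFTED siblings», (3d) «empty in the non-negative orthant»), §18 (vii).
-/

namespace Summit.Ventures.HSemireg.Pad4Tower

open Finset

section Slice

variable {C : Config} {Z : Cell}

/-- at the apex `O`, «`z ≠ 0` and not timelike» for a slice point `(a+b, a−b, 0)` means: a PURE RAY on one side
(`(a−b)² ≥ (a+b)² ⟺ ab ≤ 0 ⟺ a = 0 ∨ b = 0` over `ℕ`). -/
theorem pureRay_of_not_timelike (Q : Cell) (f : Fin 4) (hne : sliceCell Q f ≠ (0, 0, 0))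
    (hnt : ¬ Timelike (bsub (sliceCell Q f) (0, 0, 0))) : pureRay Q f 0 ∨ pureRay Q f 1 := by
  simp only [sliceCell, Timelike, ne_eq, Prod.mk.injEq, not_and, not_lt] at hne hnt
  have h0 : (Q f 0 : ℤ) * Q f 1 ≤ 0 := by nlinarith
  have hab : (Q f 0 : ℤ) * Q f 1 = 0 := le_antisymm h0 (by positivity)
  have h1 : Q f 0 = 0 ∨ Q f 1 = 0 := by
    rcases Int.mul_eq_zero.mp hab with h | h
    · left; exact_mod_cast h
    · right; exact_mod_cast h
  rcases h1 with h | h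
  · right
    refine ⟨?_, by simpa using h⟩
    intro h'
    apply hne
    · simp [h, show Q f 1 = 0 from h']
    all_goals simp [h, show Q f 1 = 0 from h']
  · left
    refine ⟨?_, by simpa using h⟩
    intro h'
    apply hne
    · simp [h, show Q f 0 = 0 from h']
    all_goals simp [h, show Q f 0 = 0 from h']

/-- nothing lies below the apex on the slice: no `P`-cell of the embedded configuration has negative causal height on any factor. -/
theorem slice_fst_nonneg (P : Cell) (f : Fin 4) : 0 ≤ (sliceCell P f).1 := by
  simp only [sliceCell]; positivity

/-- **SLICE THEOREM for the LINE form**: the (F1ℝ) `W = ∅` own-ray static kill implies the μ₄ LINE kill on the embedding, through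
either real confining direction `t`. -/
theorem staticDeadW0_slice {f' : Fin 4} {s' : Fin 2} {f'' : Fin 4} (h : StaticDeadW0 C Z f' s' f'') (t : Fin 2) :
    A2IDeadMu4Line (sliceConfig C) (sliceCell Z) f' (dirOf s') f'' (dirOf t) := by
  obtain ⟨hne, hO, hray, hconf, hlift⟩ := h
  have hZO : sliceCell Z f'' = (0, 0, 0) := by
    simp only [sliceCell, Prod.mk.injEq]; refine ⟨?_, ?_, trivial⟩ <;> simp [hO.1, hO.2]
  refine ⟨hne, ?_, adapted_slice_dirOf Z f' s', ?_, ?_, ?_, ?_⟩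
  · -- f″ is an apex point
    rw [hZO]; exact ⟨rfl, rfl⟩
  · -- the row u is demanded: 2·Z f′ s′ ≠ 0 = α(O)
    rw [coord_slice_dirOf, hZO]
    have := hray.1
    simp only [ne_eq]; omega
  · -- W_{f″}(Z) = ∅ : nothing below O
    intro w hw
    rcases hw with ⟨P', hP', -, hlt, -⟩ | ⟨g, b, -, P', hP', -, hlt, -⟩ <;>
    · obtain ⟨P, -, rfl⟩ := Finset.mem_image.1 hP'
      have := slice_fst_nonneg P f''
      rw [hZO] at hlt
      simp at hlt
      omega
  · -- no partner off the frame {u, u+2}: slice legs run in the real directions only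
    intro w hw1 hw2 P' hP' hu
    obtain ⟨P, -, rfl⟩ := Finset.mem_image.1 hP'
    obtain ⟨s₁, rfl, -, -⟩ := (uPartner_slice_iff P Z f' w).1 hu
    fin_cases s' <;> fin_cases s₁ <;> simp [dirOf] at hw1 hw2
  · -- every u-partner has a clean server in direction `dirOf t`
    intro P' hP' hu
    obtain ⟨P, hP, rfl⟩ := Finset.mem_image.1 hP'
    obtain ⟨s₁, hs₁, hag, hlt⟩ := (uPartner_slice_iff P Z f' (dirOf s')).1 hu
    have hs : s₁ = s' := by fin_cases s' <;> fin_cases s₁ <;> simp [dirOf] at hs₁ ⊢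
    subst s₁
    -- StaticDeadW0: f″ is served above at P in both directions; take direction t
    obtain ⟨N, hN, hagN, hltN⟩ : ServedAbove C P f'' t := by
      have := hconf P hP hag hlt
      fin_cases t
      · exact this.1
      · exact this.2
    refine ⟨sliceCell N, Finset.mem_image_of_mem _ hN, ?_, ?_⟩
    · -- the server is a UPartner above P in direction dirOf t
      exact (uPartner_slice_iff P N f'' (dirOf t)).2 ⟨t, rfl, fun g r hgr => (hagN g r hgr).symm, hltN⟩
    · -- no polluter: a polluter would be a lifted class
      intro Q' hQ' hpol
      obtain ⟨Q, hQ, rfl⟩ := Finset.mem_image.1 hQ'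
      obtain ⟨hC1, ⟨hdepth, hrayQ⟩, hzne, hznt, -⟩ := hpol
      apply hlift Q hQ
      -- (C3) at the O-point: a pure ray on f″
      have hpure : pureRay Q f'' 0 ∨ pureRay Q f'' 1 := by
        refine pureRay_of_not_timelike Q f'' ?_ ?_
        · rwa [hZO] at hzne
        · rwa [hZO] at hznt
      -- (C2): Q lies on Z's (f′,s′)-line strictly below Z
      have hltQ : (sliceCell Q f').1 < (sliceCell Z f').1 := lt_of_le_of_lt hdepth (by
        have := ((uPartner_slice_iff P Z f' (dirOf s')).2 ⟨s', rfl, hag, hlt⟩).2.1; exact this)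
      obtain ⟨s₂, hs₂, h2rev, h2lt⟩ : ∃ s₂ : Fin 2, dirOf s' = dirOf s₂ ∧ Q f' s₂.rev = Z f' s₂.rev ∧ Q f' s₂ < Z f' s₂ := by
        rcases (slice_ray_iff Q Z f' (dirOf s')).1 ⟨hltQ, hrayQ⟩ with ⟨h0, h1, h2⟩ | ⟨h0, h1, h2⟩
        · exact ⟨0, h0, h1, h2⟩
        · exact ⟨1, h0, h1, h2⟩
      have hs2 : s₂ = s' := by fin_cases s' <;> fin_cases s₂ <;> simp [dirOf] at hs₂ ⊢
      subst s₂
      -- (C1): agreement off {f′, f″}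
      have hoff : ∀ g, g ≠ f' → g ≠ f'' → Q g 0 = Z g 0 ∧ Q g 1 = Z g 1 :=
        fun g h1 h2 => (sliceCell_apply_eq_iff Q Z g).1 (hC1 g h1 h2)
      refine ⟨?_, h2lt, hpure⟩
      intro g r hgf hgr
      by_cases hg : g = f'
      · have hr : r ≠ s' := fun h => hgr ⟨hg, h⟩
        have : r = s'.rev := by
          fin_cases s' <;> fin_cases r <;> first | rfl | exact absurd rfl hr
        rw [hg, this]
        exact h2rev
      · rcases hoff g hg hgf with ⟨h0, h1⟩
        fin_cases r
        · exact h0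
        · exact h1

end Slice

end Summit.Ventures.HSemireg.Pad4Tower
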